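import Summits.NavierStokesRegularity.NavierStokesRegularity.Theses.TautLoopKelvin
import Summits.NavierStokesRegularity.NavierStokesRegularity.Theorems.BlowupAssembly
import Summits.NavierStokesRegularity.NavierStokesRegularity.Theorems.BlowupBlowupClayNonuniquenessRefutation
import Literature.Analysis.FluidPDE.NSQuasipotential

/-!
# Crux attack (refuter first) on `TautLoopKelvin.TautCompressionIntegrable`
(item `stmt-NavierStokesRegularity-15248`, route `route-NavierStokesRegularity-TautLoopKelvin`;
seat `refuter-rattack-stmt-NavierStokesRegularity-15248-0`, 2026-08-17). Kernel-checked findings: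

* §1 REST STATE (`u ≡ 0`): the three hypotheses are jointly satisfiable (A3, `crux_hyps_satisfiable`)
  and the conclusion HOLDS there (A4, `crux_conclusion_at_rest`: admissible class empty at every level
  `g > 0`, `sSup ∅ = 0`, `⨅ ε, 0 = 0`, `Φ := 0`, `M := 0`) — the only in-tree constructible solution is
  no counterexample, and the statement is not vacuous.
* §2 RESTATES-THE-SUMMIT PROBE, direction `S → C`: `hasSmoothExtensionPast_of_navierStokesRegularity`
  (Clay (A) ⇒ every classical Leray–Hopf solution from a rapidly decaying datum on `[0,T)` extends
  smoothly past `T`; from the tree's `blowup_assembly` + the landed `X5b`), and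
  `crux_of_navierStokesRegularity`: modulo the two TEXTBOOK dictionary facts written as hypotheses
  (`h₁` = the planner's stub 1, static bound `Λ_g(v) ≤ sup ‖Dv‖`; `h₂` = gradient persistence up to
  `T` for a solution that extends smoothly past `T`), the crux is a COROLLARY of the summit. Hence a
  refutation of the crux is (modulo `h₁`, `h₂`) a negative solution of the Millennium problem: no cheap
  kill can exist. Direction `C → S` is the route itself (`closes` needs `TautLoopLaw` and
  `CirculationFloor`); tactic probes `exact? / simp / aesop` fail both ways (Battery.lean).
-/

open MeasureTheory Set
open Literature.Analysis.FluidPDE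
open Summit.NavierStokesRegularity.NavierStokesRegularity.Theses.TautLoopKelvin

namespace Summit.NavierStokesRegularity.NavierStokesRegularity.Cruxes.TautCompressionIntegrable.Attack

set_option linter.dupNamespace false

local notation "E3" => EuclideanSpace ℝ (Fin 3)

/-! ## §1 The rest state -/

theorem hasRapidSpatialDecay_zero : HasRapidSpatialDecay (0 : E3 → E3) := by
  intro n K
  exact ⟨0, fun x => by simp⟩

/-- A3: the hypotheses of the crux are jointly satisfiable (rest state, any `ν`, `T`). -/
theorem crux_hyps_satisfiable (ν T : ℝ) :
    IsClassicalNSSolutionOn (Set.Ico 0 T) ν 0 (0 : ℝ → E3 → E3) 0 ∧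
    IsLerayHopfOn T ν 0 ((0 : ℝ → E3 → E3) 0) (0 : ℝ → E3 → E3) ∧
    HasRapidSpatialDecay ((0 : ℝ → E3 → E3) 0) :=
  ⟨isClassicalNSSolutionOn_zero _ _, isLerayHopfOn_zero T ν, hasRapidSpatialDecay_zero⟩

/-- A4: the conclusion of the crux HOLDS at the rest state, for every `T` and every level `g > 0`
(`Φ := 0`, `M := 0`; the admissible class is empty, all junk conventions land on `0 ≤ 0`). -/
theorem crux_conclusion_at_rest (T g : ℝ) (hg : 0 < g) :
    ∃ (Φ : ℝ → ℝ) (M : ℝ), Measurable Φ ∧ 0 ≤ M ∧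
      (∀ s ∈ Set.Ioo 0 T, (⨅ ε : {ε : ℝ // 0 < ε}, sSup {k : ℝ | ∃ γ : ℝ → E3,
        IsC1Loop γ ∧ g ≤ |circulation ((0 : ℝ → E3 → E3) s) γ| ∧
        ENNReal.ofReal (∫ σ in (0:ℝ)..1, ‖deriv γ σ‖) ≤
          (⨅ (γ' : ℝ → E3) (_ : IsC1Loop γ' ∧ g ≤ |circulation ((0 : ℝ → E3 → E3) s) γ'|),
            ENNReal.ofReal (∫ σ in (0:ℝ)..1, ‖deriv γ' σ‖)) + ENNReal.ofReal (ε : ℝ) ∧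
        k = ((∫ σ in (0:ℝ)..1, -(inner ℝ (deriv γ σ) (fderiv ℝ ((0 : ℝ → E3 → E3) s) (γ σ) (deriv γ σ))) /
          ‖deriv γ σ‖) / (∫ σ in (0:ℝ)..1, ‖deriv γ σ‖))}) ≤ Φ s) ∧
      (∫⁻ s in Set.Ioo 0 T, ENNReal.ofReal (Φ s)) ≤ ENNReal.ofReal M := by
  refine ⟨fun _ => 0, 0, measurable_const, le_rfl, ?_, ?_⟩
  · intro s hs
    have hempty : ∀ ε : {ε : ℝ // 0 < ε}, {k : ℝ | ∃ γ : ℝ → E3,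
        IsC1Loop γ ∧ g ≤ |circulation ((0 : ℝ → E3 → E3) s) γ| ∧
        ENNReal.ofReal (∫ σ in (0:ℝ)..1, ‖deriv γ σ‖) ≤
          (⨅ (γ' : ℝ → E3) (_ : IsC1Loop γ' ∧ g ≤ |circulation ((0 : ℝ → E3 → E3) s) γ'|),
            ENNReal.ofReal (∫ σ in (0:ℝ)..1, ‖deriv γ' σ‖)) + ENNReal.ofReal (ε : ℝ) ∧
        k = ((∫ σ in (0:ℝ)..1, -(inner ℝ (deriv γ σ) (fderiv ℝ ((0 : ℝ → E3 → E3) s) (γ σ) (deriv γ σ))) /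
          ‖deriv γ σ‖) / (∫ σ in (0:ℝ)..1, ‖deriv γ σ‖))} = ∅ := by
      intro ε
      ext k
      simp only [Set.mem_setOf_eq, Set.mem_empty_iff_false, iff_false, not_exists, not_and]
      intro γ _ hγ
      exfalso
      have : circulation ((0 : ℝ → E3 → E3) s) γ = 0 := by
        show circulation (0 : E3 → E3) γ = 0
        exact circulation_zero_left γ
      rw [this, abs_zero] at hγ
      linarith
    simp only [hempty, Real.sSup_empty, ciInf_const, le_refl]
  · simp

/-! ## §2 Restates-the-summit probe, direction `S → C` -/

/-- **Clay (A) ⇒ no blow-up in the crux's hypothesis class** (tree: `Literature.NS.blowup_assembly`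
with `X5b` = `not_not.1 BlowupBlowupClayNonuniqueness_refuted`, Tao 2013 Cor. 11.4). -/
theorem hasSmoothExtensionPast_of_navierStokesRegularity (hA : _root_.NavierStokesRegularity) :
    ∀ (ν T : ℝ), 0 < ν → 0 < T → ∀ (u : ℝ → E3 → E3) (p : ℝ → E3 → ℝ),
      IsClassicalNSSolutionOn (Set.Ico 0 T) ν 0 u p → IsLerayHopfOn T ν 0 (u 0) u →
      HasRapidSpatialDecay (u 0) → HasSmoothExtensionPast ν 0 u T := by
  intro ν T hν hT u p hcl hLH hdec
  by_contra hext
  exact Literature.NS.blowup_assembly ⟨⟨ν, hν, T, hT, u, p, ⟨hcl, hext⟩, hLH, hdec⟩, not_not.1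
    Summit.NavierStokesRegularity.NavierStokesRegularity.Theorems.BlowupBlowupClayNonuniqueness_refuted⟩ hA

/-- **`S → C` modulo the textbook dictionary.** `h₁` = the planner's registered stub 1 (static
bound `Λ_g(v) ≤ L` when `‖Dv‖ ≤ L`, provable now); `h₂` = gradient persistence: a classical
Leray–Hopf solution from a rapidly decaying datum that extends smoothly past `T` has bounded velocity
gradient on `[0,T) × ℝ³` (weak–strong uniqueness + `H^k` persistence; Kato 1984, Serrin 1962, not yet
in tree in this form). Then Clay (A) implies the crux, with `Φ := L`, `M := L·T`. -/
theorem crux_of_navierStokesRegularity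
    (h₁ : ∀ (v : E3 → E3) (L : ℝ), ContDiff ℝ 1 v → 0 ≤ L → (∀ x, ‖fderiv ℝ v x‖ ≤ L) → ∀ g : ℝ,
      (⨅ ε : {ε : ℝ // 0 < ε}, sSup {k : ℝ | ∃ γ : ℝ → E3,
        IsC1Loop γ ∧ g ≤ |circulation v γ| ∧
        ENNReal.ofReal (∫ σ in (0:ℝ)..1, ‖deriv γ σ‖) ≤
          (⨅ (γ' : ℝ → E3) (_ : IsC1Loop γ' ∧ g ≤ |circulation v γ'|),
            ENNReal.ofReal (∫ σ in (0:ℝ)..1, ‖deriv γ' σ‖)) + ENNReal.ofReal (ε : ℝ) ∧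
        k = ((∫ σ in (0:ℝ)..1, -(inner ℝ (deriv γ σ) (fderiv ℝ v (γ σ) (deriv γ σ))) / ‖deriv γ σ‖) /
          (∫ σ in (0:ℝ)..1, ‖deriv γ σ‖))}) ≤ L)
    (h₂ : ∀ (ν T : ℝ), 0 < ν → 0 < T → ∀ (u : ℝ → E3 → E3) (p : ℝ → E3 → ℝ),
      IsClassicalNSSolutionOn (Set.Ico 0 T) ν 0 u p → IsLerayHopfOn T ν 0 (u 0) u →
      HasRapidSpatialDecay (u 0) → HasSmoothExtensionPast ν 0 u T →
      ∃ L : ℝ, 0 ≤ L ∧ ∀ s ∈ Set.Ico 0 T, ∀ x, ‖fderiv ℝ (u s) x‖ ≤ L)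
    (hA : _root_.NavierStokesRegularity) : TautCompressionIntegrable := by
  intro ν T hν hT u p hcl hLH hdec g hg
  have hext := hasSmoothExtensionPast_of_navierStokesRegularity hA ν T hν hT u p hcl hLH hdec
  obtain ⟨L, hL0, hL⟩ := h₂ ν T hν hT u p hcl hLH hdec hext
  refine ⟨fun _ => L, L * T, measurable_const, mul_nonneg hL0 hT.le, ?_, ?_⟩
  · intro s hs
    have hs' : s ∈ Set.Ico 0 T := ⟨hs.1.le, hs.2⟩
    have hC1 : ContDiff ℝ 1 (u s) := (hcl.contDiff_velocity hs').of_le (by norm_cast)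
    exact h₁ (u s) L hC1 hL0 (hL s hs') g
  · show (∫⁻ s in Set.Ioo 0 T, ENNReal.ofReal L) ≤ ENNReal.ofReal (L * T)
    rw [setLIntegral_const, Real.volume_Ioo, sub_zero, ← ENNReal.ofReal_mul hL0]

/-- Contrapositive packaging: modulo the dictionary `h₁`, `h₂`, **a disproof of the crux disproves
Clay (A)** — the item cannot be closed `refuted` short of a negative solution of the summit. -/
theorem not_navierStokesRegularity_of_not_crux
    (h₁ : ∀ (v : E3 → E3) (L : ℝ), ContDiff ℝ 1 v → 0 ≤ L → (∀ x, ‖fderiv ℝ v x‖ ≤ L) → ∀ g : ℝ,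
      (⨅ ε : {ε : ℝ // 0 < ε}, sSup {k : ℝ | ∃ γ : ℝ → E3,
        IsC1Loop γ ∧ g ≤ |circulation v γ| ∧
        ENNReal.ofReal (∫ σ in (0:ℝ)..1, ‖deriv γ σ‖) ≤
          (⨅ (γ' : ℝ → E3) (_ : IsC1Loop γ' ∧ g ≤ |circulation v γ'|),
            ENNReal.ofReal (∫ σ in (0:ℝ)..1, ‖deriv γ' σ‖)) + ENNReal.ofReal (ε : ℝ) ∧
        k = ((∫ σ in (0:ℝ)..1, -(inner ℝ (deriv γ σ) (fderiv ℝ v (γ σ) (deriv γ σ))) / ‖deriv γ σ‖) /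
          (∫ σ in (0:ℝ)..1, ‖deriv γ σ‖))}) ≤ L)
    (h₂ : ∀ (ν T : ℝ), 0 < ν → 0 < T → ∀ (u : ℝ → E3 → E3) (p : ℝ → E3 → ℝ),
      IsClassicalNSSolutionOn (Set.Ico 0 T) ν 0 u p → IsLerayHopfOn T ν 0 (u 0) u →
      HasRapidSpatialDecay (u 0) → HasSmoothExtensionPast ν 0 u T →
      ∃ L : ℝ, 0 ≤ L ∧ ∀ s ∈ Set.Ico 0 T, ∀ x, ‖fderiv ℝ (u s) x‖ ≤ L)
    (hC : ¬ TautCompressionIntegrable) : ¬ _root_.NavierStokesRegularity :=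
  fun hA => hC (crux_of_navierStokesRegularity h₁ h₂ hA)

end Summit.NavierStokesRegularity.NavierStokesRegularity.Cruxes.TautCompressionIntegrable.Attack
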